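import Summits.HubbardSuperconductivity.HubbardSuperconductivity.Theorems.AnisotropyChordStiffnessAxial

/-!
# Route `AnisotropyChord` / H0 rotor rung: VARIATIONAL per-axis twist stiffness ⇒ the spectral per-axis form
# (the `m₋₁` variational characterisation; completes work-order W10 of theory seat memo ROTOR-THEORY-8 §118 (D2)/§124)

The director's hypothesis (S) was typed by the theory seat VARIATIONALLY (`UniformTwistStiffness`, axis `0`):
`2 |⟨φ, J^j_0 ψ⟩|² ≤ (⟨−T_j⟩ − Υ₀L²) · Re⟨φ, (H − E₀) φ⟩` for every `φ` in the sector — no eigenbasis.  This file proves the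
standard step to the SPECTRAL form consumed by `…StiffnessAxial`:
* `aeval_mulVec_mem_spinZSector` (sectors are invariant under polynomials of `H`), `eigen_dotProduct_aeval_mulVec`
  (`⟨vᵢ, p(H) w⟩ = p(λᵢ)⟨vᵢ, w⟩`), `eigen_dotProduct_shift_mulVec` (`⟨vᵢ, (H − E) w⟩ = (λᵢ − E)⟨vᵢ, w⟩`);
* **`twice_invMoment_le_of_variational`** : the variational bound for all sector test vectors `φ` (plus `0 ≤ B`) gives
  `2 Σᵢ |⟨vᵢ, J^j_0 ψ⟩|²/ωᵢ ≤ B` — test vector `φ₀ = g(H) J^j_0 ψ` with `g(λ) = 1/(λ − E₀)` above `E₀`, `0` otherwise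
  (a polynomial in `H`, hence in the sector; `⟨φ₀, Jψ⟩ = ⟨φ₀, (H − E₀)φ₀⟩ = m₋₁`);
* typed **`VariationalTwistStiffness Δ M`** / `VariationalTwistStiffnessN Δ M` (both axes, φ-form, with the trivial
  normalisation `Υ₀L² ≤ ⟨−T_j⟩`), the links `axialTwistStiffness_of_variational` / `…N_of_variationalN`,
  `uniformTwistStiffness_of_variational` (projection onto the theory seat's axis-`0` typing), and the END-TO-END forms
  **`eventualCondensate_of_variational_stiffness_densityResponse`** (two-state) and
  **`eventualCondensate_of_oneState_variational`** (one-state: φ-form twist stiffness on both axes + bounded density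
  response + H1⁗ ⇒ BEC).
-/

set_option linter.dupNamespace false

noncomputable section

open Matrix Complex Finset Filter Topology Polynomial
open scoped ComplexConjugate
open Literature.MathematicalPhysics.QuantumLattice hiding torusPhase torusNorm
open Literature.Probability.LatticeModels
open Summit.HubbardSuperconductivity.HubbardSuperconductivity.Theorems.AnisotropyChord.InsertionEntropy

namespace Summit.HubbardSuperconductivity.HubbardSuperconductivity.Theorems.AnisotropyChord.Stiffness

variable {L : ℕ} [NeZero L]

/-! ## Linear-algebra lemmas -/

/-- Powers of `H(Δ)` preserve every sector. [folklore] -/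
theorem pow_mulVec_mem_spinZSector (Δ M : ℝ) (n : ℕ) {v : TensorIndex (TorusSite 2 L) 2 → ℂ}
    (hv : v ∈ spinZSector (Λ := TorusSite 2 L) 1 M) :
    (hcbHamiltonian L Δ) ^ n *ᵥ v ∈ spinZSector (Λ := TorusSite 2 L) 1 M := by
  induction n generalizing v with
  | zero => simpa using hv
  | succ n ih =>
      rw [pow_succ, ← mulVec_mulVec]
      exact ih (hcb_mulVec_mem_spinZSector L Δ M hv)

/-- **Sectors are invariant under every polynomial in `H(Δ)`.** [folklore] -/
theorem aeval_mulVec_mem_spinZSector (Δ M : ℝ) (p : ℂ[X]) {v : TensorIndex (TorusSite 2 L) 2 → ℂ}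
    (hv : v ∈ spinZSector (Λ := TorusSite 2 L) 1 M) :
    aeval (hcbHamiltonian L Δ) p *ᵥ v ∈ spinZSector (Λ := TorusSite 2 L) 1 M := by
  induction p using Polynomial.induction_on' with
  | add p q hp hq =>
      rw [map_add, add_mulVec]
      exact Submodule.add_mem _ hp hq
  | monomial n c =>
      rw [Polynomial.aeval_monomial, Algebra.algebraMap_eq_smul_one, smul_mul_assoc, one_mul, Matrix.smul_mulVec]
      exact Submodule.smul_mem _ c (pow_mulVec_mem_spinZSector Δ M n hv)

/-- **`⟨vᵢ, p(H) w⟩ = p(λᵢ) ⟨vᵢ, w⟩`** for the eigenvectors of the real symmetric `H(Δ)`. [folklore] -/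
theorem eigen_dotProduct_aeval_mulVec (Δ : ℝ) (p : ℂ[X]) (i : TensorIndex (TorusSite 2 L) 2)
    (w : TensorIndex (TorusSite 2 L) 2 → ℂ) :
    star (⇑((hcbHamiltonian_isHermitian L Δ).eigenvectorBasis i)) ⬝ᵥ (aeval (hcbHamiltonian L Δ) p *ᵥ w)
      = p.eval (((hcbHamiltonian_isHermitian L Δ).eigenvalues i : ℝ) : ℂ)
          * (star (⇑((hcbHamiltonian_isHermitian L Δ).eigenvectorBasis i)) ⬝ᵥ w) := by
  set hH := hcbHamiltonian_isHermitian L Δ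
  have hPt : (aeval (hcbHamiltonian L Δ) p)ᵀ = aeval (hcbHamiltonian L Δ) p := by
    rw [transpose_aeval, xxz_transpose_eq]
  have heig : hcbHamiltonian L Δ *ᵥ ⇑(hH.eigenvectorBasis i) = ((hH.eigenvalues i : ℝ) : ℂ) • ⇑(hH.eigenvectorBasis i) := by
    rw [hH.mulVec_eigenvectorBasis i]; funext σ; simp [Pi.smul_apply]
  have hstar := star_eigenvector_mulVec (hcbHamiltonian L Δ) (xxz_entry_real Δ) heig
  rw [dotProduct_mulVec, ← Matrix.mulVec_transpose, hPt, aeval_mulVec_of_eigen _ p hstar, smul_dotProduct,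
    smul_eq_mul]

/-- **`⟨vᵢ, (H − E) w⟩ = (λᵢ − E) ⟨vᵢ, w⟩`.** [folklore] -/
theorem eigen_dotProduct_shift_mulVec (Δ E : ℝ) (i : TensorIndex (TorusSite 2 L) 2)
    (w : TensorIndex (TorusSite 2 L) 2 → ℂ) :
    star (⇑((hcbHamiltonian_isHermitian L Δ).eigenvectorBasis i))
        ⬝ᵥ ((hcbHamiltonian L Δ - ((E : ℝ) : ℂ) • (1 : Op (TorusSite 2 L) 2)) *ᵥ w)
      = ((((hcbHamiltonian_isHermitian L Δ).eigenvalues i - E : ℝ)) : ℂ)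
          * (star (⇑((hcbHamiltonian_isHermitian L Δ).eigenvectorBasis i)) ⬝ᵥ w) := by
  have h := eigen_dotProduct_aeval_mulVec Δ (X - C ((E : ℝ) : ℂ)) i w
  rw [map_sub, aeval_X, aeval_C, Algebra.algebraMap_eq_smul_one, eval_sub, eval_X, eval_C] at h
  rw [h]
  push_cast
  ring

/-- `star(g c) · c = g |c|²` for real `g`. [folklore] -/
theorem star_real_mul_mul (c : ℂ) (g : ℝ) :
    star (((g : ℝ) : ℂ) * c) * c = (((g * ‖c‖ ^ 2 : ℝ)) : ℂ) := by
  rw [star_mul', RCLike.star_def, Complex.conj_ofReal, mul_assoc, Complex.conj_mul']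
  push_cast
  ring

/-- `star(g c) · (ω · (g c)) = g |c|²` for the weight `g = [0 < ω]/ω`. [folklore] -/
theorem star_real_mul_mul_shift (c : ℂ) (ω : ℝ) :
    star ((((if 0 < ω then 1 / ω else 0 : ℝ)) : ℂ) * c)
        * (((ω : ℝ) : ℂ) * ((((if 0 < ω then 1 / ω else 0 : ℝ)) : ℂ) * c))
      = ((((if 0 < ω then 1 / ω else 0) * ‖c‖ ^ 2 : ℝ)) : ℂ) := by
  split_ifs with h
  · rw [star_mul', RCLike.star_def, Complex.conj_ofReal]
    have key : (starRingEnd ℂ) c * c = ((‖c‖ : ℝ) : ℂ) ^ 2 := Complex.conj_mul' c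
    have hω : ((ω : ℝ) : ℂ) * (((1 / ω : ℝ)) : ℂ) = 1 := by
      rw [← Complex.ofReal_mul, mul_one_div_cancel h.ne', Complex.ofReal_one]
    have e : (((1 / ω : ℝ)) : ℂ) * (starRingEnd ℂ) c * (((ω : ℝ) : ℂ) * ((((1 / ω : ℝ)) : ℂ) * c))
        = (((1 / ω : ℝ)) : ℂ) * ((starRingEnd ℂ) c * c) * (((ω : ℝ) : ℂ) * (((1 / ω : ℝ)) : ℂ)) := by ring
    rw [e, key, hω, mul_one]
    push_cast
    ring
  · simp

/-! ## The variational characterisation -/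

/-- **VARIATIONAL ⇒ SPECTRAL twist stiffness (per axis, fixed `L`).**  If `0 ≤ B` and every sector test vector `φ`
satisfies `2|⟨φ, J^j_0 ψ⟩|² ≤ B · Re⟨φ, (H − E₀)φ⟩` (`E₀` the sector ground energy, `ψ` a Perron sector amplitude), then
`2 Σᵢ |⟨vᵢ, J^j_0 ψ⟩|²/ωᵢ ≤ B`.  Test vector: `φ₀ = g(H) J^j_0 ψ`, `g = 1/(λ − E₀)` above `E₀` and `0` elsewhere. [folklore] -/
theorem twice_invMoment_le_of_variational (Δ Ms : ℝ) (a : TensorIndex (TorusSite 2 L) 2 → ℝ)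
    (ha : IsPerronSectorGroundAmplitude L Δ Ms a) (j : Fin 2) (B : ℝ) (hB : 0 ≤ B)
    (hvar : ∀ φ : TensorIndex (TorusSite 2 L) 2 → ℂ, φ ∈ spinZSector (Λ := TorusSite 2 L) 1 Ms →
      2 * ‖star φ ⬝ᵥ (currentMode L 0 j *ᵥ toC L a)‖ ^ 2
        ≤ B * (star φ ⬝ᵥ ((hcbHamiltonian L Δ
              - ((lowestEnergyInSector 1 (hcbHamiltonian L Δ) Ms : ℝ) : ℂ) • (1 : Op (TorusSite 2 L) 2)) *ᵥ φ)).re) :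
    2 * ∑ i, ‖currentAmp L Δ a 0 j i‖ ^ 2 / excitation L Δ Ms i ≤ B := by
  classical
  set hH := hcbHamiltonian_isHermitian L Δ
  set E₀ := lowestEnergyInSector 1 (hcbHamiltonian L Δ) Ms with hE₀
  -- the weights `gᵢ = 1/ωᵢ` above `E₀`, `0` elsewhere
  set g : TensorIndex (TorusSite 2 L) 2 → ℝ := fun i =>
    if 0 < excitation L Δ Ms i then 1 / excitation L Δ Ms i else 0 with hg
  have hg0 : ∀ i, 0 ≤ g i := by
    intro i; simp only [hg]; split_ifs with h
    · exact le_of_lt (one_div_pos.mpr h)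
    · exact le_rfl
  -- Lagrange interpolation of `g` on the spectrum
  obtain ⟨p, hp⟩ : ∃ p : ℂ[X], ∀ i, p.eval (((hH.eigenvalues i : ℝ)) : ℂ) = ((g i : ℝ) : ℂ) := by
    set S : Finset ℂ := Finset.univ.image fun i => ((hH.eigenvalues i : ℝ) : ℂ) with hS
    refine ⟨Lagrange.interpolate S id fun z =>
      (((if 0 < z.re - E₀ then 1 / (z.re - E₀) else 0 : ℝ)) : ℂ), fun i => ?_⟩
    have hi : ((hH.eigenvalues i : ℝ) : ℂ) ∈ S := Finset.mem_image.mpr ⟨i, Finset.mem_univ _, rfl⟩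
    have h := Lagrange.eval_interpolate_at_node (v := id)
      (fun z => (((if 0 < z.re - E₀ then 1 / (z.re - E₀) else 0 : ℝ)) : ℂ)) (Set.injOn_id _) hi
    rw [id] at h
    rw [h, Complex.ofReal_re]
    simp only [hg]
    rfl
  -- the vectors
  have hxK : currentMode L 0 j *ᵥ toC L a ∈ spinZSector (Λ := TorusSite 2 L) 1 Ms :=
    currentMode_mulVec_mem_spinZSector L 0 j Ms ha.sector
  have hφK := aeval_mulVec_mem_spinZSector Δ Ms p hxK
  have hv := hvar _ hφK
  -- amplitudes
  have hcP : ∀ i, star (⇑(hH.eigenvectorBasis i)) ⬝ᵥ (aeval (hcbHamiltonian L Δ) p *ᵥ (currentMode L 0 j *ᵥ toC L a))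
      = ((g i : ℝ) : ℂ) * currentAmp L Δ a 0 j i := by
    intro i
    rw [eigen_dotProduct_aeval_mulVec, hp i]
    rfl
  have hc : ∀ i, star (⇑(hH.eigenvectorBasis i)) ⬝ᵥ (currentMode L 0 j *ᵥ toC L a) = currentAmp L Δ a 0 j i :=
    fun i => rfl
  have hvan : ∀ i, excitation L Δ Ms i < 0 → currentAmp L Δ a 0 j i = 0 :=
    fun i hi => sectorVanishing L Δ Ms hxK i hi
  -- m := Σ gᵢ |cᵢ|²
  set m : ℝ := ∑ i, g i * ‖currentAmp L Δ a 0 j i‖ ^ 2 with hm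
  have hm0 : 0 ≤ m := Finset.sum_nonneg fun i _ => mul_nonneg (hg0 i) (sq_nonneg _)
  -- (1) ⟨φ₀, x⟩ = m
  have h1 : star (aeval (hcbHamiltonian L Δ) p *ᵥ (currentMode L 0 j *ᵥ toC L a)) ⬝ᵥ (currentMode L 0 j *ᵥ toC L a)
      = ((m : ℝ) : ℂ) := by
    have hpar := sum_dotProduct_mulVec_mul_dotProduct hH 1
      (aeval (hcbHamiltonian L Δ) p *ᵥ (currentMode L 0 j *ᵥ toC L a)) (currentMode L 0 j *ᵥ toC L a)
    simp only [Matrix.one_mulVec] at hpar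
    rw [← hpar, hm, Complex.ofReal_sum]
    refine Finset.sum_congr rfl fun i _ => ?_
    rw [Matrix.star_dotProduct (aeval (hcbHamiltonian L Δ) p *ᵥ (currentMode L 0 j *ᵥ toC L a))
      (⇑(hH.eigenvectorBasis i)), hcP i, hc i]
    exact star_real_mul_mul _ _
  -- (2) ⟨φ₀, (H − E₀) φ₀⟩ = m
  have h2 : star (aeval (hcbHamiltonian L Δ) p *ᵥ (currentMode L 0 j *ᵥ toC L a))
        ⬝ᵥ ((hcbHamiltonian L Δ - ((E₀ : ℝ) : ℂ) • (1 : Op (TorusSite 2 L) 2))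
            *ᵥ (aeval (hcbHamiltonian L Δ) p *ᵥ (currentMode L 0 j *ᵥ toC L a)))
      = ((m : ℝ) : ℂ) := by
    have hpar := sum_dotProduct_mulVec_mul_dotProduct hH 1
      (aeval (hcbHamiltonian L Δ) p *ᵥ (currentMode L 0 j *ᵥ toC L a))
      ((hcbHamiltonian L Δ - ((E₀ : ℝ) : ℂ) • (1 : Op (TorusSite 2 L) 2))
            *ᵥ (aeval (hcbHamiltonian L Δ) p *ᵥ (currentMode L 0 j *ᵥ toC L a)))
    simp only [Matrix.one_mulVec] at hpar
    rw [← hpar, hm, Complex.ofReal_sum]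
    refine Finset.sum_congr rfl fun i _ => ?_
    rw [Matrix.star_dotProduct (aeval (hcbHamiltonian L Δ) p *ᵥ (currentMode L 0 j *ᵥ toC L a))
      (⇑(hH.eigenvectorBasis i)), eigen_dotProduct_shift_mulVec, hcP i]
    have hωdef : hH.eigenvalues i - E₀ = excitation L Δ Ms i := rfl
    rw [hωdef]
    simp only [hg]
    exact star_real_mul_mul_shift _ _
  -- (3) the variational inequality at φ₀: 2 m² ≤ B m
  have h3 : 2 * m ^ 2 ≤ B * m := by
    have hnorm : ‖((m : ℝ) : ℂ)‖ ^ 2 = m ^ 2 := by rw [Complex.norm_real, Real.norm_eq_abs, sq_abs]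
    rw [h1, h2, hnorm, Complex.ofReal_re] at hv
    exact hv
  -- (4) the target equals 2m
  have h4 : ∑ i, ‖currentAmp L Δ a 0 j i‖ ^ 2 / excitation L Δ Ms i = m := by
    rw [hm]
    refine Finset.sum_congr rfl fun i _ => ?_
    by_cases hpos : 0 < excitation L Δ Ms i
    · have hgi : g i = 1 / excitation L Δ Ms i := by simp only [hg]; rw [if_pos hpos]
      rw [hgi]; ring
    · have hgi : g i = 0 := by simp only [hg]; rw [if_neg hpos]
      rcases lt_or_eq_of_le (not_lt.mp hpos) with hneg | hzero
      · rw [hvan i hneg, hgi]; simp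
      · rw [hzero, hgi]; simp
  rw [h4]
  -- (5) conclude
  rcases eq_or_lt_of_le hm0 with hmz | hmpos
  · rw [← hmz]; linarith
  · nlinarith

/-! ## The variational hypothesis, typed, and the links -/

/-- **HYPOTHESIS (S_tw, φ-form, both axes) — `VariationalTwistStiffness`**: there is `Υ₀ > 0` such that, eventually in
`L`, for the Perron reference amplitude `ψ` of sector `M_L − 1` and each axis `j`: `Υ₀L² ≤ ⟨−T_j⟩` and, for every test
vector `φ` of the sector, `2|⟨φ, J^j_0 ψ⟩|² ≤ (⟨−T_j⟩ − Υ₀L²) · Re⟨φ, (H − E₀)φ⟩` — uniform twist (Drude) stiffness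
`Υ^j ≥ Υ₀` on each axis through the variational characterisation of `m₋₁(J^j_0)`, no eigenbasis (the theory seat's
`UniformTwistStiffness` is the axis-`0` clause).  ED (kit j297117/j298465): `Υ_tw/t = 0.95–1.00`.
[conjecture: theory seat hubbard-h0-rotor-theory-1, cycle 8, 2026-08-28 — hypothesis (S_tw) of H0, variational form, both axes (memo ROTOR-THEORY-8 §103 (iv))] -/
def VariationalTwistStiffness (Δ : ℝ) (M : ℕ → ℝ) : Prop :=
  ∃ Υ₀ > (0 : ℝ), ∀ᶠ L : ℕ in atTop, ∀ [NeZero L],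
    ∀ a : TensorIndex (TorusSite 2 L) 2 → ℝ, IsPerronSectorGroundAmplitude L Δ (M L - 1) a →
      ∀ j : Fin 2, Υ₀ * (L : ℝ) ^ 2 ≤ kineticExpect L a j ∧
        ∀ φ : TensorIndex (TorusSite 2 L) 2 → ℂ, φ ∈ spinZSector (Λ := TorusSite 2 L) 1 (M L - 1) →
          2 * ‖star φ ⬝ᵥ (currentMode L 0 j *ᵥ toC L a)‖ ^ 2
            ≤ (kineticExpect L a j - Υ₀ * (L : ℝ) ^ 2)
              * (star φ ⬝ᵥ ((hcbHamiltonian L Δ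
                  - ((lowestEnergyInSector 1 (hcbHamiltonian L Δ) (M L - 1) : ℝ) : ℂ)
                      • (1 : Op (TorusSite 2 L) 2)) *ᵥ φ)).re

/-- **HYPOTHESIS (S_tw, φ-form, both axes)^N — `VariationalTwistStiffnessN`**: the same for the Perron amplitude of the
sector `M_L` itself (one-state chain). [conjecture: theory seat hubbard-h0-rotor-theory-1, cycle 9, 2026-08-28 — hypothesis (S_tw) of H0, variational form, both axes, N-sector] -/
def VariationalTwistStiffnessN (Δ : ℝ) (M : ℕ → ℝ) : Prop :=
  ∃ Υ₀ > (0 : ℝ), ∀ᶠ L : ℕ in atTop, ∀ [NeZero L],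
    ∀ a : TensorIndex (TorusSite 2 L) 2 → ℝ, IsPerronSectorGroundAmplitude L Δ (M L) a →
      ∀ j : Fin 2, Υ₀ * (L : ℝ) ^ 2 ≤ kineticExpect L a j ∧
        ∀ φ : TensorIndex (TorusSite 2 L) 2 → ℂ, φ ∈ spinZSector (Λ := TorusSite 2 L) 1 (M L) →
          2 * ‖star φ ⬝ᵥ (currentMode L 0 j *ᵥ toC L a)‖ ^ 2
            ≤ (kineticExpect L a j - Υ₀ * (L : ℝ) ^ 2)
              * (star φ ⬝ᵥ ((hcbHamiltonian L Δ
                  - ((lowestEnergyInSector 1 (hcbHamiltonian L Δ) (M L) : ℝ) : ℂ)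
                      • (1 : Op (TorusSite 2 L) 2)) *ᵥ φ)).re

/-- The φ-form contains the theory seat's axis-`0` typing `UniformTwistStiffness`. [folklore] -/
theorem uniformTwistStiffness_of_variational (Δ : ℝ) (M : ℕ → ℝ) (h : VariationalTwistStiffness Δ M) :
    UniformTwistStiffness Δ M := by
  obtain ⟨Υ₀, hΥ₀, hev⟩ := h
  refine ⟨Υ₀, hΥ₀, ?_⟩
  filter_upwards [hev] with L hL
  intro _ a ha φ hφ
  exact (hL a ha 0).2 φ hφ

/-- **φ-form ⇒ spectral per-axis stiffness (PROVED).** [folklore] -/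
theorem axialTwistStiffness_of_variational (Δ : ℝ) (M : ℕ → ℝ) (h : VariationalTwistStiffness Δ M) :
    AxialTwistStiffness Δ M := by
  obtain ⟨Υ₀, hΥ₀, hev⟩ := h
  refine ⟨Υ₀, hΥ₀, ?_⟩
  filter_upwards [hev] with L hL
  intro _ a ha j
  obtain ⟨hB, hφ⟩ := hL a ha j
  exact twice_invMoment_le_of_variational Δ (M L - 1) a ha j _ (by linarith) hφ

/-- **φ-form ⇒ spectral per-axis stiffness, `N`-sector (PROVED).** [folklore] -/
theorem axialTwistStiffnessN_of_variationalN (Δ : ℝ) (M : ℕ → ℝ) (h : VariationalTwistStiffnessN Δ M) :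
    AxialTwistStiffnessN Δ M := by
  obtain ⟨Υ₀, hΥ₀, hev⟩ := h
  refine ⟨Υ₀, hΥ₀, ?_⟩
  filter_upwards [hev] with L hL
  intro _ a ha j
  obtain ⟨hB, hφ⟩ := hL a ha j
  exact twice_invMoment_le_of_variational Δ (M L) a ha j _ (by linarith) hφ

/-- **THE H0 ROTOR RUNG, φ-FORM STIFFNESS (two-state chain):** «variational twist stiffness on both axes + bounded density
response (K′) + infrared Gaussianity (H1′) ⇒ BEC» on the density window. [folklore] -/
theorem eventualCondensate_of_variational_stiffness_densityResponse (Δ : ℝ) (M : ℕ → ℝ) (ρ : ℝ)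
    (hρ : ρ ∈ Set.Ioo (0 : ℝ) 1)
    (hlim : Tendsto (fun L : ℕ => 1 / 2 + M L / (L : ℝ) ^ 2) atTop (nhds ρ))
    (hsect : ∀ᶠ L : ℕ in atTop, ∀ [NeZero L], spinZSector (Λ := TorusSite 2 L) 1 (M L - 1) ≠ ⊥)
    (hS : VariationalTwistStiffness Δ M) (hK : BoundedDensityResponse Δ M)
    (hG : GaussianInsertionComparison Δ M) : EventualCondensate Δ M :=
  eventualCondensate_of_axial_stiffness_densityResponse Δ M ρ hρ hlim hsect
    (axialTwistStiffness_of_variational Δ M hS) hK hG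

/-- **THE ONE-STATE H0 ROTOR RUNG, φ-FORM STIFFNESS:** along `ρ_L → ρ ∈ (0,1)`, «variational twist stiffness on both
axes (S_tw)^N + bounded density response (K′)^N + Gaussian domination of one conditional pair (H1⁗) ⇒ BEC», every
hypothesis on one sector sequence and free of eigenbases except (K′)'s spectral sum; every analytic input a theorem. [folklore] -/
theorem eventualCondensate_of_oneState_variational (Δ : ℝ) (M : ℕ → ℝ) (ρ : ℝ)
    (hρ : ρ ∈ Set.Ioo (0 : ℝ) 1)
    (hlim : Tendsto (fun L : ℕ => 1 / 2 + M L / (L : ℝ) ^ 2) atTop (nhds ρ))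
    (hS : VariationalTwistStiffnessN Δ M) (hK : BoundedDensityResponseN Δ M)
    (hG : TeleGaussianComparison Δ M) : EventualCondensate Δ M :=
  eventualCondensate_of_oneState_axial Δ M ρ hρ hlim (axialTwistStiffnessN_of_variationalN Δ M hS) hK hG

end Summit.HubbardSuperconductivity.HubbardSuperconductivity.Theorems.AnisotropyChord.Stiffness
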